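import Mathlib

/-!
# Vectorised local certificates: list arithmetic for kernel evaluation and its bridge to `Finset` sums

Support file of the one-cut programme (crux `NoHeavyLowerTail`, stmt-CriticalPhenomena-4575; unit `prim-lf-1` gen 58, memo
`FROM-prim-lf-1-gen58-Q311-LEAN-AND-PROFILE-NOGO.md` §6).  The block theorems `P₁ ∧ Q` of this lane are proved from machine-found LOCAL
CERTIFICATES `T₀(π,π') ≥ Σ_j λ_j Φ_j(π,π')` (a finite inequality between sorted fibre profiles, checked by kernel `decide`) plus the goodness of `P₁`.
For blocks whose certificates have many terms (tri5, p4c: hundreds of columns over `K ≈ 30–80` words) the term-by-term transcription of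
`…AndPerfect4` / `…AndQ311` is impractical; instead one writes the certificate as a BILINEAR FORM `Σ_{i,j} M_{ij} w_j(π) w_i(π')` with a non-negative
integer matrix `M` over the word vector `w(π) ∈ ℤ^K`.  This file provides the two halves of that design, independent of any block:
* `dotL`, `mulVecL` — dot product / matrix–vector product on `List ℤ`, cheap for the kernel (`decide` evaluates the left profile's `M·w(π)` once
  and then one length-`K` dot product per profile pair);
* `dotL_ofFn`, `mulVecL_ofFn`, `bilin_ofFn` — the bridge to `Finset` sums over `Fin K` (`dotL (mulVecL M w) w' = Σ_i (Σ_j M i j * w j) * w' i`);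
* **`sum_bilin_nonneg`** — the assembly step: if `M ≥ 0` entrywise and every cross moment `Σ_{x∈P} a_x(j) b_x(i)` is `≥ 0` (in the applications:
  `sum_mul_nonneg_of_two` from the goodness of `P₁`), then `Σ_{x∈P} Σ_i (Σ_j M i j * a_x j) * b_x i ≥ 0`.
HONEST LABEL: elementary infrastructure (list/`Fin` bookkeeping), standard axioms; no block theorem is proved here. [this work]
-/

namespace Summit.CriticalPhenomena.PercolationContinuityZ3.Theorems

namespace VecCert

open Finset

/-- Dot product of two integer lists (truncating to the shorter one). [this work] -/
def dotL : List ℤ → List ℤ → ℤ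
  | a :: as, b :: bs => a * b + dotL as bs
  | _, _ => 0

/-- Matrix (list of rows) times vector. [this work] -/
def mulVecL (M : List (List ℤ)) (w : List ℤ) : List ℤ := M.map fun row => dotL row w

/-- `dotL` on two `List.ofFn`s of the same length is the `Finset` sum of the products. [this work] -/
theorem dotL_ofFn {K : ℕ} (f g : Fin K → ℤ) : dotL (List.ofFn f) (List.ofFn g) = ∑ i, f i * g i := by
  induction K with
  | zero => simp [dotL]
  | succ K ih =>
    rw [List.ofFn_succ, List.ofFn_succ, dotL, ih, Fin.sum_univ_succ]

/-- `mulVecL` on `List.ofFn` data. [this work] -/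
theorem mulVecL_ofFn {K J : ℕ} (M : Fin K → Fin J → ℤ) (g : Fin J → ℤ) :
    mulVecL (List.ofFn fun i => List.ofFn (M i)) (List.ofFn g) = List.ofFn fun i => ∑ j, M i j * g j := by
  unfold mulVecL
  rw [List.map_ofFn]
  congr 1
  funext i
  simp only [Function.comp_apply, dotL_ofFn]

/-- The bilinear form `w'ᵀ (M w)` computed with lists equals the double `Finset` sum. [this work] -/
theorem bilin_ofFn {K : ℕ} (M : Fin K → Fin K → ℤ) (f g : Fin K → ℤ) :
    dotL (mulVecL (List.ofFn fun i => List.ofFn (M i)) (List.ofFn f)) (List.ofFn g) = ∑ i, (∑ j, M i j * f j) * g i := by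
  rw [mulVecL_ofFn, dotL_ofFn]

/-- **Assembly lemma.**  An entrywise non-negative matrix applied to non-negative cross moments gives a non-negative total:
`0 ≤ Σ_{x∈P} Σ_i (Σ_j M i j * a x j) * b x i` whenever `0 ≤ M i j` and `0 ≤ Σ_{x∈P} a x j * b x i` for all `i, j`. [this work] -/
theorem sum_bilin_nonneg {X : Type} {K : ℕ} (P : Finset X) (M : Fin K → Fin K → ℤ) (hM : ∀ i j, 0 ≤ M i j)
    (a b : X → Fin K → ℤ) (hS : ∀ i j, 0 ≤ ∑ x ∈ P, a x j * b x i) :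
    0 ≤ ∑ x ∈ P, ∑ i, (∑ j, M i j * a x j) * b x i := by
  have h : ∑ x ∈ P, ∑ i, (∑ j, M i j * a x j) * b x i = ∑ i, ∑ j, M i j * ∑ x ∈ P, a x j * b x i := by
    rw [sum_comm]
    refine sum_congr rfl fun i _ => ?_
    rw [show (∑ x ∈ P, (∑ j, M i j * a x j) * b x i) = ∑ x ∈ P, ∑ j, M i j * (a x j * b x i) from
      sum_congr rfl fun x _ => by rw [sum_mul]; exact sum_congr rfl fun j _ => by ring]
    rw [sum_comm]
    exact sum_congr rfl fun j _ => by rw [mul_sum]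
  rw [h]
  exact sum_nonneg fun i _ => sum_nonneg fun j _ => mul_nonneg (hM i j) (hS i j)

/-- Variant of the assembly lemma with the word vectors given as lists through `List.ofFn` (the form in which `decide`d profile lemmas are
stated). [this work] -/
theorem sum_dotL_mulVecL_nonneg {X : Type} {K : ℕ} (P : Finset X) (M : Fin K → Fin K → ℤ) (hM : ∀ i j, 0 ≤ M i j)
    (a b : X → Fin K → ℤ) (hS : ∀ i j, 0 ≤ ∑ x ∈ P, a x j * b x i) :
    0 ≤ ∑ x ∈ P, dotL (mulVecL (List.ofFn fun i => List.ofFn (M i)) (List.ofFn (a x))) (List.ofFn (b x)) := by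
  simp only [bilin_ofFn]
  exact sum_bilin_nonneg P M hM a b hS

end VecCert

end Summit.CriticalPhenomena.PercolationContinuityZ3.Theorems
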